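import Literature.RepresentationTheory.Virasoro.VirasoroModule

/-!
# Verma modules, the Kac table and the Kac quotients `K_{r,s}` of the Virasoro algebra

The **Verma module** of central charge `c` and highest weight `h` is the induced module
`V(c,h) = M(c,h) = U(Vir) ⊗_{U(Vir^{≥0})} ℂ_{c,h}` (Iohara–Koga Definition 1.17; Di
Francesco–Mathieu–Sénéchal §7.1.1), equivalently (Kytölä–Ridout §2) "the quotient of
`U = U(Vir)/(C - c1)` (regarded as a vir-module under left-multiplication) by the left-ideal `I`
generated by `L_0 - h1, L_1` and `L_2`" (`L_1, L_2` generate `vir⁺`). We realise this literally and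
without choosing a basis: `U` is the free algebra `A = ℂ⟨x_n : n ∈ ℤ⟩` modulo the two-sided ideal
of the Virasoro relators, so `V(c,h) = A ⧸ J(c,h)` with `J(c,h)` the LEFT ideal generated by the
right multiples of the relators, the letters `x_n` (`n > 0`) and `x_0 - h`; `L_n` acts as left
multiplication by `x_n` (`Verma.rep`), the class of `1` is the highest-weight vector `v_{c,h}`
(`Verma.hw`: `L_n v = 0` for `n > 0`, `L_0 v = h v`, `V = A·v` — all proved), and the universal
property (Iohara–Koga Prop. 1.6 (1)): for every representation `W` of central charge `c` and
primary `w ∈ W` of weight `h` an intertwiner `Verma.lift : V(c,h) → W`, `v_{c,h} ↦ w` (proved: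
`lift_hw`, `lift_L`). Also proved: `U·w = U⁻·w` — the subrepresentation generated by a primary
vector is the span of the PBW words on it (`VirasoroRep.generated_singleton_eq_pbwSpan`), `V(c,h)`
is generated by `v_{c,h}` (`Verma.generated_hw_eq_top`) and spanned by the PBW words
(`Verma.pbwSpan_hw_eq_top`). Nothing about the SIZE of `V(c,h)` (linear independence of the words
`e_𝕀 v_{c,h}`, `𝕀 ⊢ n`; `dim V(c,h)_{h+n} = p(n)`, Kytölä–Ridout (2.8)) is asserted here.

The **Kac table** (Feigin–Fuchs parametrisation, Iohara–Koga (5.4), Kytölä–Ridout (2.2), DMS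
(7.31)): `c(t) = 13 - 6(t + t⁻¹)`, `h_{r,s}(t) = ¼(r² - 1)t - ½(rs - 1) + ¼(s² - 1)t⁻¹`
(`centralChargeOf`, `kacWeight`). For `r, s ≥ 1` the Verma module `V(c(t), h_{r,s}(t))` has a
singular vector of level `rs`, unique up to scale (Iohara–Koga Prop. 5.1), generating a submodule
`≅ V(c(t), h_{r,s} + rs)`; the **Kac quotient** is
`K_{r,s} := V_{h_{r,s}} / V_{h_{r,s}+rs}` (Pearce–Rasmussen–Zuber 2006 §2.2, there `Q_{r,s}`;
Kytölä–Ridout footnote 7: `V_0/V_1`, `V_2/V_h` at `c = 0`). We define it as the quotient of the Verma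
module by the subrepresentation generated by ALL its primary vectors of weight `h_{r,s} + rs`
(`KacModule t r s`, with its action `KacModule.rep`, generator `KacModule.hw`, proved primary of
weight `h_{r,s}`), which is that submodule, and record its character
`χ_{r,s} = q^{h_{r,s}} (1 - q^{rs}) / ∏ (1 - qⁿ)` (PRZ §2.2) as the named fact `KacCharacter`.

## Not here

The PBW basis theorem / `dim V(c,h)_{h+n} = p(n)`, the Shapovalov form, the Kac determinant
(Iohara–Koga Thm 4.2) and the existence of the level-`rs` singular vector, embedding diagrams
(Feigin–Fuchs), irreducible quotients `L(c,h)`, staggered modules.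
-/

noncomputable section

namespace Literature.RepresentationTheory.Virasoro

/-! ### Descendant spaces of primary vectors: `U·w = U⁻·w` is spanned by the PBW words -/

namespace VirasoroRep

variable {c : ℂ} {V : Type*} [AddCommGroup V] [Module ℂ V] (R : VirasoroRep c V)

/-- The span of all words `L_{-k₁} ⋯ L_{-k_j} w` on a vector `w`. [cite: KytolaRidout2009, §2 ("V_{h,c} = U⁻ v_{h,c}")] -/
def pbwSpan (w : V) : Submodule ℂ V :=
  Submodule.span ℂ (Set.range fun l : List ℕ => R.pbwVector l w)

/-- Words lie in the word span. [folklore] -/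
theorem pbwVector_mem_pbwSpan (w : V) (l : List ℕ) : R.pbwVector l w ∈ R.pbwSpan w :=
  Submodule.subset_span ⟨l, rfl⟩

/-- The word span is stable under the lowering generators `L_{-k}`, `k ≥ 0`. [folklore] -/
theorem L_neg_mem_pbwSpan (w : V) (k : ℕ) {x : V} (hx : x ∈ R.pbwSpan w) :
    R.L (-(k : ℤ)) x ∈ R.pbwSpan w := by
  induction hx using Submodule.span_induction with
  | mem x hx =>
    obtain ⟨l, rfl⟩ := hx
    exact R.pbwVector_mem_pbwSpan w (k :: l)
  | zero => rw [map_zero]; exact zero_mem _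
  | add x y _ _ hx hy => rw [map_add]; exact add_mem hx hy
  | smul a x _ hx => rw [map_smul]; exact Submodule.smul_mem _ a hx

/-- For a PRIMARY `w`, every `L_n` maps every word on `w` into the word span (commute `L_n` to the
right through the word, using the relations, until it hits `w`).
[cite: DiFrancescoMathieuSenechal1997, §7.1.1 (evaluation of (7.9) "by passing the L_{k_j} over the L_{-l_i}")] -/
theorem L_pbwVector_mem_pbwSpan {w : V} {h : ℂ} (hw : R.IsPrimary w h) (l : List ℕ) (n : ℤ) :
    R.L n (R.pbwVector l w) ∈ R.pbwSpan w := by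
  induction l generalizing n with
  | nil =>
    rw [pbwVector_nil]
    rcases lt_trichotomy n 0 with hn | rfl | hn
    · have h1 := R.pbwVector_mem_pbwSpan w [n.natAbs]
      rwa [pbwVector_cons, pbwVector_nil, show -((n.natAbs : ℕ) : ℤ) = n by omega] at h1
    · rw [hw.weight]
      exact Submodule.smul_mem _ _ (R.pbwVector_mem_pbwSpan w [])
    · rw [hw.annihilated n hn]
      exact zero_mem _
  | cons k l ih =>
    rw [pbwVector_cons, R.comm_apply n (-(k : ℤ))]
    exact add_mem (add_mem (R.L_neg_mem_pbwSpan w k (ih n)) (Submodule.smul_mem _ _ (ih _)))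
      (Submodule.smul_mem _ _ (R.pbwVector_mem_pbwSpan w l))

/-- For a primary `w` the word span is a subrepresentation. [cite: DiFrancescoMathieuSenechal1997, §7.1.3 ("Such a state generates its own Verma module")] -/
theorem isInvariant_pbwSpan {w : V} {h : ℂ} (hw : R.IsPrimary w h) : R.IsInvariant (R.pbwSpan w) := by
  intro n x hx
  induction hx using Submodule.span_induction with
  | mem x hx =>
    obtain ⟨l, rfl⟩ := hx
    exact R.L_pbwVector_mem_pbwSpan hw l n
  | zero => rw [map_zero]; exact zero_mem _
  | add x y _ _ hx hy => rw [map_add]; exact add_mem hx hy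
  | smul a x _ hx => rw [map_smul]; exact Submodule.smul_mem _ a hx

/-- **`U·w = U⁻·w`**: the subrepresentation generated by a primary vector `w` is the span of the
words `L_{-k₁} ⋯ L_{-k_j} w` (so a highest-weight module is spanned by the descendants of its
highest-weight vector). [cite: KytolaRidout2009, §2 ("V_{h,c} = U⁻ v_{h,c}")] [cite: IoharaKoga2011, Definition 1.16] -/
theorem generated_singleton_eq_pbwSpan {w : V} {h : ℂ} (hw : R.IsPrimary w h) :
    R.generated {w} = R.pbwSpan w := by
  apply le_antisymm
  · exact R.generated_le (Set.singleton_subset_iff.mpr (R.pbwVector_mem_pbwSpan w []))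
      (R.isInvariant_pbwSpan hw)
  · refine Submodule.span_le.mpr ?_
    rintro _ ⟨l, rfl⟩
    exact R.pbwVector_mem (R.isInvariant_generated {w})
      (R.subset_generated {w} (Set.mem_singleton w)) l

end VirasoroRep

/-! ### Verma modules

`V(c,h) = U ⊗_{U(vir^{≥0})} ℂ_{c,h} ≅ U / (U·(L_0 - h) + Σ_{n>0} U·L_n)` with `U = U(Vir)/(C - c)`; we
realise `U` as the free algebra on generators `x_n` (`n ∈ ℤ`) modulo the Virasoro relators, so that
`V(c,h)` is the quotient of the free algebra `A = ℂ⟨x_n : n ∈ ℤ⟩`, as a left `A`-module, by the left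
ideal generated by the two-sided relator ideal together with `x_0 - h` and the `x_n`, `n > 0`. -/

section Verma

/-- The free generator `x_n` (the letter standing for `L_n`) of the free algebra `ℂ⟨x_n : n ∈ ℤ⟩`.
[folklore] -/
abbrev gen (n : ℤ) : FreeAlgebra ℂ ℤ := FreeAlgebra.ι ℂ n

/-- The Virasoro relator `x_m x_n - x_n x_m - (m - n) x_{m+n} - (c/12)(m³ - m)δ_{m+n,0}` at central
charge `c` (generators of the ideal defining `U = U(Vir)/(C - c1)`).
[cite: KytolaRidout2009, §2 (eq. (2.1) and the quotient U)] -/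
def relator (c : ℂ) (m n : ℤ) : FreeAlgebra ℂ ℤ :=
  gen m * gen n - gen n * gen m - ((m : ℂ) - n) • gen (m + n) - algebraMap ℂ _ (centralTerm c m n)

/-- The left ideal `J(c,h) ⊆ ℂ⟨x_n⟩` of the Verma module: generated (as a left ideal) by the right
multiples `relator c m n * b` of the relators (i.e. it contains the two-sided relator ideal), by the
raising letters `x_n`, `n > 0`, and by `x_0 - h`.
[cite: KytolaRidout2009, §2 ("the quotient of U … by the left-ideal I generated by L₀ - h1, L₁ and L₂")]
[cite: IoharaKoga2011, Definition 1.17] -/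
def vermaIdeal (c h : ℂ) : Submodule (FreeAlgebra ℂ ℤ) (FreeAlgebra ℂ ℤ) :=
  Submodule.span (FreeAlgebra ℂ ℤ)
    (({a | ∃ (m n : ℤ) (b : FreeAlgebra ℂ ℤ), a = relator c m n * b} ∪
        {a | ∃ n : ℤ, 0 < n ∧ a = gen n}) ∪
      {gen 0 - algebraMap ℂ _ h})

/-- The **Verma module** `V(c,h) = U(Vir) ⊗_{U(vir^{≥0})} ℂ_{c,h} ≅ ℂ⟨x_n⟩ / J(c,h)` of central
charge `c` and highest (conformal) weight `h`, as a complex vector space with a left action of the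
free algebra (the letters `x_n` acting as the `L_n`). [cite: IoharaKoga2011, Definition 1.17]
[cite: KytolaRidout2009, §2] [cite: DiFrancescoMathieuSenechal1997, §7.1.1] -/
abbrev Verma (c h : ℂ) : Type := FreeAlgebra ℂ ℤ ⧸ vermaIdeal c h

namespace Verma

variable {c h : ℂ}

/-- The relators act by zero on `V(c,h)`. [cite: KytolaRidout2009, §2] -/
theorem relator_smul (m n : ℤ) (x : Verma c h) : relator c m n • x = 0 := by
  obtain ⟨b, rfl⟩ := Submodule.Quotient.mk_surjective _ x
  rw [← Submodule.Quotient.mk_smul, smul_eq_mul, Submodule.Quotient.mk_eq_zero]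
  exact Submodule.subset_span (Or.inl (Or.inl ⟨m, n, b, rfl⟩))

variable (c h) in
/-- The **Virasoro action on the Verma module** `V(c,h)`: `L_n` is left multiplication by the
letter `x_n`. [cite: IoharaKoga2011, Definition 1.17] [cite: KytolaRidout2009, §2] -/
def rep : VirasoroRep c (Verma c h) where
  L n := Algebra.lsmul ℂ ℂ (Verma c h) (gen n)
  lie m n x := by
    have h0 := relator_smul (c := c) (h := h) m n x
    simp only [relator, sub_smul, mul_smul, smul_assoc, algebraMap_smul] at h0
    rw [sub_sub, sub_eq_zero] at h0
    simpa [sub_smul] using h0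

/-- `L_n` acts on `V(c,h)` as the letter `x_n`. [folklore] -/
theorem L_apply (n : ℤ) (x : Verma c h) : (rep c h).L n x = gen n • x := rfl

variable (c h) in
/-- The **highest-weight vector** `v_{c,h} = [1]` of the Verma module.
[cite: IoharaKoga2011, §1.2.5 (the vector 1 ⊗ 1)] [cite: KytolaRidout2009, §2 ("the equivalence class of the unit [1]")] -/
def hw : Verma c h := Submodule.Quotient.mk 1

/-- `a • v_{c,h} = [a]`. [folklore] -/
theorem smul_hw (a : FreeAlgebra ℂ ℤ) : a • hw c h = Submodule.Quotient.mk a := by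
  rw [hw, ← Submodule.Quotient.mk_smul, smul_eq_mul, mul_one]

/-- **Cyclicity**: every vector of `V(c,h)` is `a • v_{c,h}` for a word `a` in the generators
(`V(c,h) = U · v_{c,h}`). [cite: KytolaRidout2009, §2 ("V_{h,c} = U⁻ v_{h,c}")] -/
theorem exists_smul_hw (x : Verma c h) : ∃ a : FreeAlgebra ℂ ℤ, x = a • hw c h := by
  obtain ⟨a, rfl⟩ := Submodule.Quotient.mk_surjective _ x
  exact ⟨a, (smul_hw a).symm⟩

/-- `L_n v_{c,h} = 0` for `n > 0`. [cite: DiFrancescoMathieuSenechal1997, eq. (7.6)] -/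
theorem L_hw_of_pos {n : ℤ} (hn : 0 < n) : (rep c h).L n (hw c h) = 0 := by
  rw [L_apply, smul_hw, Submodule.Quotient.mk_eq_zero]
  exact Submodule.subset_span (Or.inl (Or.inr ⟨n, hn, rfl⟩))

/-- `L_0 v_{c,h} = h v_{c,h}`. [cite: DiFrancescoMathieuSenechal1997, eq. (7.5)] -/
theorem L_zero_hw : (rep c h).L 0 (hw c h) = h • hw c h := by
  rw [L_apply, smul_hw]
  have h1 : (Submodule.Quotient.mk (gen 0 - algebraMap ℂ _ h) : Verma c h) = 0 :=
    (Submodule.Quotient.mk_eq_zero _).mpr (Submodule.subset_span (Or.inr rfl))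
  rw [Submodule.Quotient.mk_sub, sub_eq_zero] at h1
  rw [h1, hw, ← Submodule.Quotient.mk_smul, Algebra.algebraMap_eq_smul_one]

/-- `v_{c,h}` is primary of weight `h`. [cite: DiFrancescoMathieuSenechal1997, eqs. (7.5)–(7.6)] -/
theorem isPrimary_hw : (rep c h).IsPrimary (hw c h) h :=
  ⟨fun _ hn => L_hw_of_pos hn, L_zero_hw⟩

/-- The descendant `L_{-k₁} ⋯ L_{-k_j} v_{c,h}` has weight `h + Σ kᵢ`. [cite: DiFrancescoMathieuSenechal1997, eq. (7.8)] -/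
theorem pbwVector_hw_mem_weightSpace (l : List ℕ) :
    (rep c h).pbwVector l (hw c h) ∈ (rep c h).weightSpace (h + (l.sum : ℕ)) :=
  (rep c h).pbwVector_mem_weightSpace isPrimary_hw.mem_weightSpace l

/-- **`V(c,h) = U · v_{c,h}`**: the Verma module is generated, as a representation, by its
highest-weight vector. [cite: IoharaKoga2011, Definition 1.16 and §1.2.5 ("M(α,λ) is a highest weight module")] -/
theorem generated_hw_eq_top : (rep c h).generated {hw c h} = ⊤ := by
  rw [eq_top_iff]
  rintro x -
  obtain ⟨a, rfl⟩ := exists_smul_hw x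
  suffices H : ∀ g ∈ (rep c h).generated {hw c h}, a • g ∈ (rep c h).generated {hw c h} from
    H _ ((rep c h).subset_generated _ (Set.mem_singleton _))
  induction a using FreeAlgebra.induction with
  | grade0 r => intro g hg; rw [algebraMap_smul]; exact Submodule.smul_mem _ r hg
  | grade1 n => intro g hg; exact (rep c h).isInvariant_generated _ n g hg
  | mul a b ha hb => intro g hg; rw [mul_smul]; exact ha _ (hb g hg)
  | add a b ha hb => intro g hg; rw [add_smul]; exact add_mem (ha g hg) (hb g hg)

/-- Hence `V(c,h)` is spanned by the PBW words `L_{-k₁} ⋯ L_{-k_j} v_{c,h}` (the spanning half of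
the PBW basis theorem). [cite: KytolaRidout2009, §2, the basis before eq. (2.8)] -/
theorem pbwSpan_hw_eq_top : (rep c h).pbwSpan (hw c h) = ⊤ := by
  rw [← (rep c h).generated_singleton_eq_pbwSpan isPrimary_hw, generated_hw_eq_top]

/-! #### The universal property (Iohara–Koga Prop. 1.6 (1)) -/

section lift

variable {W : Type*} [AddCommGroup W] [Module ℂ W] (S : VirasoroRep c W) {w : W}

/-- The evaluation `a ↦ a(L) w` of words in the generators on a vector `w` of another representation.
[folklore] -/
def evalAt (w : W) : FreeAlgebra ℂ ℤ →ₗ[ℂ] W :=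
  (LinearMap.applyₗ w).comp (FreeAlgebra.lift ℂ S.L).toLinearMap

/-- Unfolding of `evalAt`. [folklore] -/
theorem evalAt_apply (w : W) (a : FreeAlgebra ℂ ℤ) : evalAt S w a = FreeAlgebra.lift ℂ S.L a w := rfl

/-- The relators evaluate to `0` in every representation. [cite: KytolaRidout2009, §2] -/
theorem lift_relator (m n : ℤ) : FreeAlgebra.lift ℂ S.L (relator c m n) = 0 := by
  ext x
  simp only [relator, map_sub, map_mul, map_smul, FreeAlgebra.lift_ι_apply, AlgHom.commutes,
    LinearMap.sub_apply, Module.End.mul_apply, LinearMap.smul_apply, LinearMap.zero_apply,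
    Module.algebraMap_end_apply]
  rw [S.lie m n x, sub_sub, sub_self]

/-- The Verma left ideal kills every primary vector of weight `h` (at the same central charge).
[cite: KytolaRidout2009, §2, eq. (2.9)] -/
theorem vermaIdeal_le_ker (hw' : S.IsPrimary w h) :
    (vermaIdeal c h).restrictScalars ℂ ≤ LinearMap.ker (evalAt S w) := by
  intro a ha
  rw [Submodule.restrictScalars_mem] at ha
  rw [LinearMap.mem_ker]
  induction ha using Submodule.span_induction with
  | mem a ha =>
    rcases ha with (⟨m, n, b, rfl⟩ | ⟨n, hn, rfl⟩) | ha
    · rw [evalAt_apply, map_mul, lift_relator, zero_mul, LinearMap.zero_apply]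
    · rw [evalAt_apply, FreeAlgebra.lift_ι_apply, hw'.annihilated n hn]
    · rw [Set.mem_singleton_iff] at ha
      rw [ha, evalAt_apply, map_sub, FreeAlgebra.lift_ι_apply, AlgHom.commutes, LinearMap.sub_apply,
        Module.algebraMap_end_apply, hw'.weight, sub_self]
  | zero => exact map_zero _
  | add a b _ _ ha hb => rw [map_add, ha, hb, add_zero]
  | smul b a _ ha =>
    rw [evalAt_apply] at ha
    rw [smul_eq_mul, evalAt_apply, map_mul, Module.End.mul_apply, ha, map_zero]

/-- **Universal property of the Verma module**: for every representation `W` of central charge `c`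
and every primary vector `w ∈ W` of weight `h` there is an intertwiner `V(c,h) → W` with
`v_{c,h} ↦ w` (whose image is the highest-weight module `U·w`).
[cite: IoharaKoga2011, Proposition 1.6 (1)] -/
def lift (hw' : S.IsPrimary w h) : Verma c h →ₗ[ℂ] W :=
  (((vermaIdeal c h).restrictScalars ℂ).liftQ (evalAt S w) (vermaIdeal_le_ker S hw')).comp
    (Submodule.Quotient.restrictScalarsEquiv ℂ (vermaIdeal c h)).symm.toLinearMap

/-- The lift on classes of words: `[a] ↦ a(L) w`. [folklore] -/
theorem lift_mk (hw' : S.IsPrimary w h) (a : FreeAlgebra ℂ ℤ) :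
    lift S hw' (Submodule.Quotient.mk a) = FreeAlgebra.lift ℂ S.L a w := by
  simp [lift, evalAt_apply]

/-- The lift sends the highest-weight vector to `w`. [cite: IoharaKoga2011, Proposition 1.6 (1)] -/
theorem lift_hw (hw' : S.IsPrimary w h) : lift S hw' (hw c h) = w := by
  rw [hw, lift_mk, map_one, Module.End.one_apply]

/-- The lift intertwines the Virasoro actions. [cite: IoharaKoga2011, Proposition 1.6 (1)] -/
theorem lift_L (hw' : S.IsPrimary w h) (n : ℤ) (x : Verma c h) :
    lift S hw' ((rep c h).L n x) = S.L n (lift S hw' x) := by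
  obtain ⟨a, rfl⟩ := Submodule.Quotient.mk_surjective _ x
  rw [L_apply, ← Submodule.Quotient.mk_smul, smul_eq_mul, lift_mk, lift_mk, map_mul,
    FreeAlgebra.lift_ι_apply, Module.End.mul_apply]

end lift

end Verma

end Verma

/-! ### The Kac table and the Kac quotients `K_{r,s}` -/

section Kac

/-- The central charge `c(t) = 13 - 6(t + t⁻¹)` (Feigin–Fuchs parametrisation; `t ↔ t⁻¹` symmetric;
`t = p/p'` rational for the minimal / logarithmic models). [cite: IoharaKoga2011, eq. (5.4)]
[cite: KytolaRidout2009, eq. (2.2)] [cite: DiFrancescoMathieuSenechal1997, eq. (7.31)] -/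
def centralChargeOf (t : ℂ) : ℂ := 13 - 6 * (t + t⁻¹)

/-- The **Kac table** `h_{r,s}(t) = ¼(r² - 1)t - ½(rs - 1) + ¼(s² - 1)t⁻¹` (at `c = c(t)` and
`h = h_{r,s}(t)`, `r, s ≥ 1`, the Verma module has a singular vector of level `rs`).
[cite: IoharaKoga2011, eq. (5.4)] [cite: DiFrancescoMathieuSenechal1997, eq. (7.31)] -/
def kacWeight (t : ℂ) (r s : ℤ) : ℂ :=
  ((r : ℂ) ^ 2 - 1) / 4 * t - ((r : ℂ) * s - 1) / 2 + ((s : ℂ) ^ 2 - 1) / 4 * t⁻¹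

/-- `c(t⁻¹) = c(t)`. [cite: KytolaRidout2009, eq. (2.2) ("clearly symmetric under t ↔ t⁻¹")] -/
theorem centralChargeOf_inv (t : ℂ) : centralChargeOf t⁻¹ = centralChargeOf t := by
  simp only [centralChargeOf, inv_inv, add_comm]

/-- `h_{r,s}(t) = h_{s,r}(t⁻¹)`. [cite: IoharaKoga2011, eq. (5.4)] -/
theorem kacWeight_swap (t : ℂ) (r s : ℤ) : kacWeight t r s = kacWeight t⁻¹ s r := by
  simp only [kacWeight, inv_inv]
  ring

/-- `h_{1,1}(t) = 0` (the vacuum). [cite: IoharaKoga2011, eq. (5.4)] -/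
theorem kacWeight_one_one (t : ℂ) : kacWeight t 1 1 = 0 := by
  simp [kacWeight]

/-- The **Kac quotient** (Kac module) `K_{r,s} = V(c(t), h_{r,s}(t)) / ⟨singular vectors of level rs⟩`:
the Verma module modulo the subrepresentation generated by its primary vectors of weight
`h_{r,s} + rs` (for `r, s ≥ 1` these span the line of the level-`rs` singular vector, so that
`K_{r,s} = V_{h_{r,s}} / V_{h_{r,s}+rs}`; for `r = 0` or `s = 0` the generating vector itself is
quotiented and the junk value is the zero module). [cite: PearceRasmussenZuber2006, §2.2 (Q_{r,s} := V_{Δ_{r,s}}/V_{Δ_{r,-s}}, Δ_{r,-s} = Δ_{r,s} + rs)]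
[cite: KytolaRidout2009, §2 ("If there is a singular vector w ∈ V_{h,c} at grade n, then it generates a submodule isomorphic to V_{h+n,c}") and footnote 7 (H^L = V₀/V₁, H^R = V₂/V_h at c = 0)]
[cite: IoharaKoga2011, Proposition 5.1] -/
abbrev KacModule (t : ℂ) (r s : ℕ) : Type :=
  Verma (centralChargeOf t) (kacWeight t r s) ⧸
    (Verma.rep (centralChargeOf t) (kacWeight t r s)).primarySpan (kacWeight t r s + (r * s : ℕ))

namespace KacModule

variable (t : ℂ) (r s : ℕ)

/-- The Virasoro action on `K_{r,s}` (quotient action). [cite: KytolaRidout2009, §2] -/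
def rep : VirasoroRep (centralChargeOf t) (KacModule t r s) :=
  (Verma.rep _ _).quotient _ ((Verma.rep _ _).isInvariant_generated _)

/-- The image `x_{r,s}` of `v_{c,h_{r,s}}` in `K_{r,s}`. [cite: KytolaRidout2009, §2] -/
def hw : KacModule t r s := Submodule.Quotient.mk (Verma.hw _ _)

/-- `x_{r,s}` is primary of weight `h_{r,s}(t)`. [cite: KytolaRidout2009, §2] -/
theorem isPrimary_hw : (rep t r s).IsPrimary (hw t r s) (kacWeight t r s) :=
  Verma.isPrimary_hw.mkQ _ _

/-- Every vector of `K_{r,s}` is a word in the generators applied to `x_{r,s}`. [cite: KytolaRidout2009, §2] -/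
theorem exists_smul_hw (x : KacModule t r s) :
    ∃ a : FreeAlgebra ℂ ℤ, x = Submodule.Quotient.mk (a • Verma.hw _ _) := by
  obtain ⟨y, rfl⟩ := Submodule.Quotient.mk_surjective _ x
  obtain ⟨a, rfl⟩ := Verma.exists_smul_hw y
  exact ⟨a, rfl⟩

/-- In `K_{r,s}` every primary vector of `V(c, h_{r,s})` of weight `h_{r,s} + rs` has been set to
zero. [cite: KytolaRidout2009, §2] -/
theorem mk_eq_zero_of_isPrimary {w : Verma (centralChargeOf t) (kacWeight t r s)}
    (hw' : (Verma.rep _ _).IsPrimary w (kacWeight t r s + (r * s : ℕ))) :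
    (Submodule.Quotient.mk w : KacModule t r s) = 0 :=
  (Submodule.Quotient.mk_eq_zero _).mpr ((Verma.rep _ _).subset_generated _ hw')

end KacModule

/-- **Character of the Kac quotient** (named fact): for `t ≠ 0` and `r, s ≥ 1` the graded dimension
of `K_{r,s}` at weight `h_{r,s}(t) + n` is `p(n) - p(n - rs)` (with `p(m) = 0` for `m < 0`), i.e.
`χ_{r,s}(q) = q^{-c/24} q^{h_{r,s}} (1 - q^{rs}) / ∏_{n ≥ 1} (1 - qⁿ)`: the level-`rs` singular
vector of `V(c(t), h_{r,s}(t))` exists, is unique up to scale, and generates a Verma submodule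
`V_{h_{r,s}+rs}` of character `q^{h+rs}/∏(1 - qⁿ)`, while `dim V(c,h)_{h+n} = p(n)`.
[cite: PearceRasmussenZuber2006, §2.2 (character of Q_{r,s} = V_{Δ_{r,s}}/V_{Δ_{r,-s}})]
[cite: KytolaRidout2009, §2, eq. (2.8) and the paragraph on singular vectors]
[cite: IoharaKoga2011, Proposition 5.1] -/
def KacCharacter : Prop :=
  ∀ (t : ℂ), t ≠ 0 → ∀ (r s : ℕ), 1 ≤ r → 1 ≤ s → ∀ n : ℕ,
    (KacModule.rep t r s).gradedDim (kacWeight t r s + n) =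
      Fintype.card (Nat.Partition n) - (if r * s ≤ n then Fintype.card (Nat.Partition (n - r * s)) else 0)

end Kac

end Literature.RepresentationTheory.Virasoro

end
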